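import Literature.IUT.LogVolume.DifferentEstimatesCorollaries
import Literature.IUT.LogVolume.FundamentalIdentity
import Literature.IUT.LogVolume.PadicSubfields
import HarnessLib

/-!
# [IUTchIV] Prop. 1.2 constants: an ABSOLUTE bound `d + a + b < 4 + 2·log_p [K : ℚ_p]` for a finite extension `K/ℚ_p`, `p > 2`

Proof-only companion (classical local number theory; nothing disputed) of the campaign-S files
`RamificationInvariants` (`logRadiusA`, `logRadiusB` = the exponents `a`, `b` of [IUTchIV] Prop. 1.2, p. 10),
`IntegerRing` (`differentOrd` = `d`) and `DifferentEstimatesCorollaries` (`differentOrd_lt`, Lenstra's bound /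
[IUTchIV] Prop. 1.3). PURPOSE (abc-iut cell, branch C, seat abc-iut-C-cert-1; brick (H3) of the «HEX-KERNEL» sizing of
2026-08-26): every explicit depth threshold of the cell's sharp-setting refutations
(`Summit.ABC.IUTFork.Thm311.Real.not_licence_settingPrVolSharp_of_realises_explicit`,
`Summit.ABC.IUTFork.Conditional.not_hSH_v6K_of_exists_deep`) carries the exponent `(j+1)·(d + a + b) + 1` of the
completion `K = K_{x₀}` at one bad place; to decide it at a datum whose field is known only through its DEGREE one
needs a bound of `d + a + b` by the degree alone. Here:

* `differentOrd_padic_eq_zero` — `d(ℚ_p) = 0`;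
* `differentOrd_lt_one_add_padicValNat_finrank` — `d(K) < 1 + v_p([K : ℚ_p])` (`differentOrd_lt` at `k₀ = ℚ_p`);
* `absRamificationIdx_le_finrank` — `e ≤ [K : ℚ_p]` (fundamental identity `e·f = [K : ℚ_p]`, `f ≥ 1`);
* `logRadiusA_le_two` — `a = ⌈e/(p−2)⌉/e ≤ 2` for `p > 2`; `logRadiusB_le` — `b ≤ 1 + log_p e`;
* `depthConstants_lt` — **`d + a + b < 4 + 2·log_p [K : ℚ_p]`** for `p > 2`.

[cite: Mochizuki2012, IUTchIV Prop. 1.2 p. 10, Prop. 1.3 p. 12] [cite: SerreLocalFields1979, Ch. III §6 Prop. 13]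
-/

noncomputable section

namespace Literature.IUT.LogVolume

open Module

variable (p : ℕ) [Fact p.Prime]
variable (K : Type*) [NontriviallyNormedField K] [NormedAlgebra ℚ_[p] K] [IsUltrametricDist K] [ProperSpace K]

/-- `d(ℚ_p) = 0`: the different of `ℤ_p/ℤ_p` is trivial (`e = 1`, tame case `d = (e−1)/e`).
[cite: SerreLocalFields1979, Ch. III §6 Prop. 13] -/
theorem differentOrd_padic_eq_zero : differentOrd p ℚ_[p] = 0 := by
  have h1 : absRamificationIdx p ℚ_[p] = 1 := absRamificationIdx_padic p
  have hnd : ¬ p ∣ absRamificationIdx p ℚ_[p] := by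
    rw [h1, Nat.dvd_one]
    exact (Fact.out : p.Prime).one_lt.ne'
  rw [differentOrd_eq_of_not_dvd p ℚ_[p] hnd, h1]
  simp

/-- **`d(K) < 1 + v_p([K : ℚ_p])`** — Lenstra's bound `differentOrd_lt` ([IUTchIV] Prop. 1.3) over the base `k₀ = ℚ_p`
(`d(ℚ_p) = 0`, `e(ℚ_p) = 1`). [cite: Mochizuki2012, IUTchIV Prop. 1.3 p. 12] -/
theorem differentOrd_lt_one_add_padicValNat_finrank :
    differentOrd p K < 1 + padicValNat p (finrank ℚ_[p] K) := by
  have h := differentOrd_lt p ℚ_[p] K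
  rw [differentOrd_padic_eq_zero, absRamificationIdx_padic] at h
  simpa using h

/-- **`e ≤ [K : ℚ_p]`** (from `e·f = [K : ℚ_p]` and `f ≥ 1`). [cite: SerreLocalFields1979, Ch. I §4 Prop. 10] -/
theorem absRamificationIdx_le_finrank : absRamificationIdx p K ≤ finrank ℚ_[p] K := by
  have h := absRamificationIdx_mul_residueDegree p K
  have hf := residueDegree_pos p K
  calc absRamificationIdx p K = absRamificationIdx p K * 1 := (mul_one _).symm
    _ ≤ absRamificationIdx p K * residueDegree p K := Nat.mul_le_mul_left _ hf
    _ = finrank ℚ_[p] K := h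

omit [Fact p.Prime] in
/-- **`a ≤ 2`** for `p > 2` and `e ≥ 1`: `a = ⌈e/(p−2)⌉/e ≤ (e/(p−2) + 1)/e = 1/(p−2) + 1/e ≤ 2`.
[cite: Mochizuki2012, IUTchIV Prop. 1.2 p. 10] -/
theorem logRadiusA_le_two {e : ℕ} (hp : 2 < p) (he : 1 ≤ e) : logRadiusA p e ≤ 2 := by
  have hp' : p ≠ 2 := by omega
  have hpR : (1 : ℝ) ≤ (p : ℝ) - 2 := by
    have : (3 : ℝ) ≤ p := by exact_mod_cast hp
    linarith
  have heR : (1 : ℝ) ≤ e := by exact_mod_cast he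
  have he0 : (0 : ℝ) < e := by linarith
  rw [logRadiusA, if_neg hp']
  have hceil : (⌈(e : ℝ) / ((p : ℝ) - 2)⌉ : ℝ) < (e : ℝ) / ((p : ℝ) - 2) + 1 := Int.ceil_lt_add_one _
  have hdiv : (e : ℝ) / ((p : ℝ) - 2) ≤ e := by
    rw [div_le_iff₀ (by linarith)]
    nlinarith
  rw [div_le_iff₀ he0]
  linarith

omit [Fact p.Prime] in
/-- **`b ≤ 1 + log_p e`** for `p > 1` and `e ≥ 1`: `b = ⌊log(p·e/(p−1))/log p⌋ − 1/e ≤ log_p(p·e/(p−1)) ≤ log_p(p·e)`.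
[cite: Mochizuki2012, IUTchIV Prop. 1.2 p. 10] -/
theorem logRadiusB_le {e : ℕ} (hp : 1 < p) (he : 1 ≤ e) : logRadiusB p e ≤ 1 + Real.logb p e := by
  have hpR : (1 : ℝ) < p := by exact_mod_cast hp
  have hp0 : (0 : ℝ) < p := by linarith
  have heR : (1 : ℝ) ≤ e := by exact_mod_cast he
  have he0 : (0 : ℝ) < e := by linarith
  have hlogp : 0 < Real.log p := Real.log_pos hpR
  rw [logRadiusB]
  have hfloor : (⌊Real.log ((p : ℝ) * e / ((p : ℝ) - 1)) / Real.log p⌋ : ℝ) ≤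
      Real.log ((p : ℝ) * e / ((p : ℝ) - 1)) / Real.log p := Int.floor_le _
  -- `p·e/(p−1) ≤ p·e` since `p − 1 ≥ 1`
  have hp2 : (2 : ℝ) ≤ p := by exact_mod_cast hp
  have hq : (p : ℝ) * e / ((p : ℝ) - 1) ≤ (p : ℝ) * e := by
    rw [div_le_iff₀ (by linarith)]
    have hpe : 0 ≤ (p : ℝ) * e := (mul_pos hp0 he0).le
    nlinarith [mul_le_mul_of_nonneg_left (show (1 : ℝ) ≤ (p : ℝ) - 1 by linarith) hpe]
  have hq0 : 0 < (p : ℝ) * e / ((p : ℝ) - 1) := div_pos (mul_pos hp0 he0) (by linarith)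
  have hlog : Real.log ((p : ℝ) * e / ((p : ℝ) - 1)) / Real.log p ≤ 1 + Real.logb p e := by
    have h1 : Real.log ((p : ℝ) * e / ((p : ℝ) - 1)) ≤ Real.log ((p : ℝ) * e) := Real.log_le_log hq0 hq
    have h2 : Real.log ((p : ℝ) * e) = Real.log p + Real.log e := Real.log_mul hp0.ne' he0.ne'
    rw [Real.logb, div_le_iff₀ hlogp, add_mul, one_mul, div_mul_cancel₀ _ hlogp.ne']
    linarith
  have hinv : (0 : ℝ) ≤ 1 / e := by positivity
  linarith

/-- **`d + a + b < 4 + 2·log_p [K : ℚ_p]`** for `p > 2`: the exponent constants of [IUTchIV] Prop. 1.2 at a finite extension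
`K/ℚ_p` are bounded by the DEGREE alone (`d < 1 + v_p(n) ≤ 1 + log_p n`, `a ≤ 2`, `b ≤ 1 + log_p e ≤ 1 + log_p n`, `n = [K : ℚ_p]`).
[cite: Mochizuki2012, IUTchIV Prop. 1.2 p. 10, Prop. 1.3 p. 12] -/
theorem depthConstants_lt (hp : 2 < p) :
    differentOrd p K + logRadiusA p (absRamificationIdx p K) + logRadiusB p (absRamificationIdx p K) <
      4 + 2 * Real.logb p (finrank ℚ_[p] K) := by
  have hp1 : 1 < p := by omega
  have hpR : (1 : ℝ) < p := by exact_mod_cast hp1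
  have he1 : 1 ≤ absRamificationIdx p K := absRamificationIdx_pos p K
  have hen : absRamificationIdx p K ≤ finrank ℚ_[p] K := absRamificationIdx_le_finrank p K
  have hn1 : 1 ≤ finrank ℚ_[p] K := he1.trans hen
  have hd := differentOrd_lt_one_add_padicValNat_finrank p K
  have ha := logRadiusA_le_two (p := p) hp he1
  have hb := logRadiusB_le (p := p) hp1 he1
  -- `v_p(n) ≤ log_p n`
  have hv : (padicValNat p (finrank ℚ_[p] K) : ℝ) ≤ Real.logb p (finrank ℚ_[p] K) := by
    have h1 : (padicValNat p (finrank ℚ_[p] K) : ℝ) ≤ (Nat.log p (finrank ℚ_[p] K) : ℝ) := by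
      exact_mod_cast padicValNat_le_nat_log (finrank ℚ_[p] K)
    exact h1.trans (Real.natLog_le_logb _ _)
  -- `log_p e ≤ log_p n`
  have hle : Real.logb p (absRamificationIdx p K) ≤ Real.logb p (finrank ℚ_[p] K) :=
    Real.logb_le_logb_of_le hpR (by exact_mod_cast he1) (by exact_mod_cast hen)
  linarith

end Literature.IUT.LogVolume

end
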